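import Summits.Ventures.HSemireg.WedgeHankelRankProfileTrapezoid
import Summits.Ventures.HSemireg.WedgeHankelSpikes
import Summits.Ventures.HSemireg.WedgeHankelOuterImage

/-!
# Venture HSemireg — THE CENSUS OF RANK ROWS: over EVERY field and for every `N`, the rank rows `k ↦ rank H_k(q)` of ALL coefficient sequences `q` are EXACTLY the `⌊N/2⌋ + 2`
# trapezoids `k ↦ min(k + 1, N + 1 − k, r)`, `0 ≤ r ≤ ⌊N/2⌋ + 1` — one integer `R(q) = rank H_{⌊N/2⌋}(q)` per class, every value attained (by the pure powers `δ_p`), the rows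
# totally ordered; with THEOREM H the DIMENSION rows `k ↦ dim V(univ, w_N(q), k) = C(N,k) · min(k+1, N+1−k, R(q))` are exactly `⌊N/2⌋ + 2` as well

HONEST FRAMING. Part of the Lean index of the computation cell `pub-hsemireg` (seat p10 gen 25, Sunday typer «UNIFORM-IN-n»).
LINEAR ALGEBRA OF HANKEL (catalecticant) MATRICES over a field + th-7's THEOREM H ONLY: no variety, no cohomology theory, no sheaf, no Ext group and no semiregularity map is constructed
here; nothing here says that HC / HC_CM / HC_AV holds; no Literature fact is declared or used.  Custodian versions as in `WedgeHankelSiegelIdeal` (1/3); the dictionary (`rank H_k(q)` =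
the Hankel factor of THEOREM H, `V(univ, w_N(q), k)` = the image of `θ ↦ θ ∧ w_N(q)` on `⋀^k`, `δ_p` = the pure power `Θ^p/p!`) is QUOTED, never asserted.

WHAT IS IN THE TREE / KEYED.  N15 (`WedgeHankelRankProfileTrapezoid`, keyed; CHAINED on N13, N14) THE TRAPEZOID LAW `rank_hankel1_eq_min` (`k ≤ N`:
`rank H_k(q) = min(min(k+1, N+1−k), rank H_{⌊N/2⌋}(q))`); p10 g10's SPIKE LAW `HankelSpikes.rank_hankel1_spikeSeq_eq_min` (`rank H_k(δ_p) = min(k+1, N+1−k, p+1, N+1−p)`),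
`rank_hankel1_spikeSeq_eq_zero`; THEOREM H `HankelFrameChange.finrank_V_w` (`dim V(univ, w_N(q), k) = C(N,k) · rank H_k(q)`) and `HankelSiegelIdeal.finrank_Kr_w_add_rank`
(`dim Kr + C(N,k) · rank H_k = C(2N,k)`); K41 (`WedgeHankelOuterImage`) `finrank_V_w_letters` / `finrank_Kr_w_letters_add` (the same with `C(|T|,k)` for the sub-box of the pairs in ANY
pair set `T`); Mathlib `Set.InjOn.ncard_image`, `Set.ncard_coe_finset`, `Nat.card_Iic`.
THIS FILE (namespace `Summit.Ventures.HSemireg.Wedge.HankelOuter` continued; CHAINED on N15; imports `WedgeHankelSpikes` for the pure powers and K41 for the sub-boxes):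
* §460 ONE INTEGER PER CLASS: `rank_hankel1_eq_min'` (the trapezoid law for EVERY `k`, both sides `0` above the top), `rank_hankel1_half_le` (`R(q) ≤ ⌊N/2⌋ + 1`),
  **`finrank_V_w_eq_choose_mul_min`** (`dim V(univ, w_N(q), k) = C(N,k) · min(min(k+1, N+1−k), R(q))`), `finrank_Kr_w_eq_sub` (the kernel row
  `dim Kr(univ, w_N(q), k) = C(2N,k) − C(N,k) · min(…)`), **`finrank_V_w_letters_eq_choose_mul_min`** / `finrank_Kr_w_letters_eq_sub` (the same rows for the sub-box of the pairs in
  EVERY pair set `T`, with `|T|` for `N`: one trapezoid serves all sub-boxes), **`rank_hankel1_mono_of_half_le`** / `rank_hankel1_total` (the rank rows of any two classes are COMPARABLE degree by degree),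
  `forall_rank_hankel1_eq_iff` / **`forall_finrank_V_w_eq_iff`** (two classes have the same rank row — equivalently the same dimension row — iff `R(q) = R(q')`).
* §461 EVERY VALUE OCCURS, AND THE COUNT: `rank_hankel1_half_spikeSeq` (`R(δ_p) = p + 1` for `p ≤ ⌊N/2⌋`), `exists_rank_hankel1_half_eq` (every `0 ≤ r ≤ ⌊N/2⌋ + 1` is some `R(q)`),
  **`range_rankRow_eq`** (the set of rank rows IS the set of the `⌊N/2⌋ + 2` trapezoids), **`ncard_range_rankRow`** (exactly `⌊N/2⌋ + 2` rank rows) and **`ncard_range_finrankRow`**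
  (exactly `⌊N/2⌋ + 2` dimension rows `k ↦ dim V(univ, w_N(q), k)` among all classes `w_N(q)`, `q : ℕ → K`).
READING: the census tables of FORMULA-N (one dimension row per class) can show at most `⌊N/2⌋ + 2` distinct rows for classes `w_N(q)`, and all of them occur already for the pure powers
`1, Θ, Θ²/2!, …, Θ^{⌊N/2⌋}/⌊N/2⌋!` and `0`; which row a class has is decided by the single rank `R(q)` in the middle degree (Sylvester's window, H3).  Nothing Ext-side.  New names only.
-/

open Module

namespace Summit.Ventures.HSemireg.Wedge.HankelOuter

open Summit.Ventures.HSemireg.Wedge Summit.Ventures.HSemireg.Wedge.Kunneth Summit.Ventures.HSemireg.Wedge.Hankel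
  Summit.Ventures.HSemireg.Wedge.BasisFree Summit.Ventures.HSemireg.Wedge.HankelSiegel Summit.Ventures.HSemireg.Wedge.HankelSiegelIdeal
  Summit.Ventures.HSemireg.Wedge.KunnethKernel Summit.Ventures.HSemireg.Wedge.HankelFrameChange Summit.Ventures.HSemireg.Wedge.KernelDuality
  Summit.Ventures.HSemireg.Wedge.HankelSpikes

variable (K : Type*) [Field K] {N : ℕ}

/-! ## §460. One integer per class -/

/-- **`rank H_k(q) = min(min(k + 1, N + 1 − k), R(q))` for EVERY `k`**, `R(q) = rank H_{⌊N/2⌋}(q)` (above the top degree both sides vanish). -/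
theorem rank_hankel1_eq_min' (k : ℕ) (q : ℕ → K) :
    (hankel1 K N k q).rank = min (min (k + 1) (N + 1 - k)) ((hankel1 K N (N / 2) q).rank) := by
  rcases le_or_gt k N with hk | hk
  · exact rank_hankel1_eq_min K hk q
  · have h0 : (hankel1 K N k q).rank = 0 := by
      have hw := Matrix.rank_le_width (hankel1 K N k q)
      omega
    rw [h0, show N + 1 - k = 0 by omega, Nat.min_zero, Nat.zero_min]

/-- **`R(q) ≤ ⌊N/2⌋ + 1`.** -/
theorem rank_hankel1_half_le (q : ℕ → K) : (hankel1 K N (N / 2) q).rank ≤ N / 2 + 1 :=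
  Matrix.rank_le_height _

/-- **THE DIMENSION ROW OF EVERY CLASS: `dim V(univ, w_N(q), k) = C(N,k) · min(min(k + 1, N + 1 − k), R(q))`** (THEOREM H × the trapezoid law; every `k`, every field). -/
theorem finrank_V_w_eq_choose_mul_min (k : ℕ) (q : ℕ → K) :
    finrank K ↥(V K (In N) Finset.univ (w K N N q) k) = N.choose k * min (min (k + 1) (N + 1 - k)) ((hankel1 K N (N / 2) q).rank) := by
  rw [finrank_V_w, rank_hankel1_eq_min']

/-- **THE KERNEL ROW OF EVERY CLASS: `dim Kr(univ, w_N(q), k) = C(2N,k) − C(N,k) · min(min(k + 1, N + 1 − k), R(q))`.** -/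
theorem finrank_Kr_w_eq_sub (k : ℕ) (q : ℕ → K) :
    finrank K ↥(Kr K Finset.univ (w K N N q) k) = (N + N).choose k - N.choose k * min (min (k + 1) (N + 1 - k)) ((hankel1 K N (N / 2) q).rank) := by
  have h := finrank_Kr_w_add_rank K (n := N) k q
  rw [rank_hankel1_eq_min'] at h
  omega

/-- **THE SAME TRAPEZOID FOR EVERY SUB-BOX OF PAIRS: `dim V(letters T, w_N(q), k) = C(|T|,k) · min(min(k + 1, N + 1 − k), R(q))`** for every pair set `T ⊆ [N]` (K41 × the trapezoid law). -/
theorem finrank_V_w_letters_eq_choose_mul_min (T : Finset (Fin N)) (k : ℕ) (q : ℕ → K) :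
    finrank K ↥(V K (In N) (Finset.univ.filter fun i : In N => Weil.pr i ∈ T) (w K N N q) k) = T.card.choose k * min (min (k + 1) (N + 1 - k)) ((hankel1 K N (N / 2) q).rank) := by
  rw [finrank_V_w_letters, rank_hankel1_eq_min']

/-- **… and the kernel row of every sub-box of pairs: `dim Kr(letters T, w_N(q), k) = C(2|T|,k) − C(|T|,k) · min(min(k + 1, N + 1 − k), R(q))`.** -/
theorem finrank_Kr_w_letters_eq_sub (T : Finset (Fin N)) (k : ℕ) (q : ℕ → K) :
    finrank K ↥(Kr K (Finset.univ.filter fun i : In N => Weil.pr i ∈ T) (w K N N q) k)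
      = (T.card + T.card).choose k - T.card.choose k * min (min (k + 1) (N + 1 - k)) ((hankel1 K N (N / 2) q).rank) := by
  have h := finrank_Kr_w_letters_add K T k q
  rw [rank_hankel1_eq_min'] at h
  omega

/-- **THE RANK ROWS FORM A CHAIN: `R(q) ≤ R(q') ⇒ rank H_k(q) ≤ rank H_k(q')` in every degree `k`.** -/
theorem rank_hankel1_mono_of_half_le {q q' : ℕ → K} (h : (hankel1 K N (N / 2) q).rank ≤ (hankel1 K N (N / 2) q').rank) (k : ℕ) :
    (hankel1 K N k q).rank ≤ (hankel1 K N k q').rank := by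
  rw [rank_hankel1_eq_min' K k q, rank_hankel1_eq_min' K k q']
  exact min_le_min_left _ h

/-- … so the rank rows of any two classes are comparable degree by degree. -/
theorem rank_hankel1_total (q q' : ℕ → K) :
    (∀ k, (hankel1 K N k q).rank ≤ (hankel1 K N k q').rank) ∨ (∀ k, (hankel1 K N k q').rank ≤ (hankel1 K N k q).rank) := by
  rcases le_total ((hankel1 K N (N / 2) q).rank) ((hankel1 K N (N / 2) q').rank) with h | h
  · exact Or.inl (rank_hankel1_mono_of_half_le K h)
  · exact Or.inr (rank_hankel1_mono_of_half_le K h)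

/-- **two classes have the same rank row iff `R(q) = R(q')`.** -/
theorem forall_rank_hankel1_eq_iff (q q' : ℕ → K) :
    (∀ k, (hankel1 K N k q).rank = (hankel1 K N k q').rank) ↔ (hankel1 K N (N / 2) q).rank = (hankel1 K N (N / 2) q').rank :=
  ⟨fun h => h _, fun h k => by rw [rank_hankel1_eq_min' K k q, rank_hankel1_eq_min' K k q', h]⟩

/-- **two classes have the same DIMENSION row `k ↦ dim V(univ, w_N(·), k)` iff `R(q) = R(q')`** (THEOREM H; `C(N, ⌊N/2⌋) ≠ 0`). -/
theorem forall_finrank_V_w_eq_iff (q q' : ℕ → K) :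
    (∀ k, finrank K ↥(V K (In N) Finset.univ (w K N N q) k) = finrank K ↥(V K (In N) Finset.univ (w K N N q') k))
      ↔ (hankel1 K N (N / 2) q).rank = (hankel1 K N (N / 2) q').rank := by
  constructor
  · intro h
    have h1 := h (N / 2)
    rw [finrank_V_w, finrank_V_w] at h1
    exact Nat.eq_of_mul_eq_mul_left (Nat.choose_pos (Nat.div_le_self N 2)) h1
  · intro h k
    rw [finrank_V_w_eq_choose_mul_min, finrank_V_w_eq_choose_mul_min, h]

/-! ## §461. Every value occurs; the count -/

/-- **`R(δ_p) = p + 1` for `p ≤ ⌊N/2⌋`** (the spike law in the middle degree). -/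
theorem rank_hankel1_half_spikeSeq {p : ℕ} (hp : p ≤ N / 2) : (hankel1 K N (N / 2) (spikeSeq K p)).rank = p + 1 := by
  rw [rank_hankel1_spikeSeq_eq_min K (Nat.div_le_self N 2) (show p ≤ N by omega), min_eq_left (show p + 1 ≤ N + 1 - p by omega)]
  exact min_eq_right (le_min (by omega) (by omega))

/-- **every `0 ≤ r ≤ ⌊N/2⌋ + 1` is `R(q)` for some `q`** (`δ_{N+1}` for `r = 0`, `δ_{r−1}` otherwise). -/
theorem exists_rank_hankel1_half_eq {r : ℕ} (hr : r ≤ N / 2 + 1) : ∃ q : ℕ → K, (hankel1 K N (N / 2) q).rank = r := by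
  rcases r with _ | p
  · exact ⟨spikeSeq K (N + 1), rank_hankel1_spikeSeq_eq_zero K (Nat.div_le_self N 2) (Nat.lt_succ_self N)⟩
  · exact ⟨spikeSeq K p, rank_hankel1_half_spikeSeq K (by omega)⟩

/-- **THE CENSUS OF RANK ROWS: `{k ↦ rank H_k(q) : q} = {k ↦ min(min(k + 1, N + 1 − k), r) : 0 ≤ r ≤ ⌊N/2⌋ + 1}`.** -/
theorem range_rankRow_eq :
    Set.range (fun q : ℕ → K => fun k => (hankel1 K N k q).rank) = (fun r k => min (min (k + 1) (N + 1 - k)) r) '' Set.Iic (N / 2 + 1) := by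
  ext f
  simp only [Set.mem_range, Set.mem_image, Set.mem_Iic]
  constructor
  · rintro ⟨q, rfl⟩
    exact ⟨_, rank_hankel1_half_le K q, funext fun k => (rank_hankel1_eq_min' K k q).symm⟩
  · rintro ⟨r, hr, rfl⟩
    obtain ⟨q, hq⟩ := exists_rank_hankel1_half_eq K hr
    exact ⟨q, funext fun k => by rw [rank_hankel1_eq_min' K k q, hq]⟩

/-- the trapezoids `k ↦ min(min(k + 1, N + 1 − k), r)`, `r ≤ ⌊N/2⌋ + 1`, are pairwise distinct (read off `r` in the middle degree). -/
theorem injOn_trapezoidRow : Set.InjOn (fun (r : ℕ) (k : ℕ) => min (min (k + 1) (N + 1 - k)) r) (Set.Iic (N / 2 + 1)) := by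
  intro r hr r' hr' h
  rw [Set.mem_Iic] at hr hr'
  have h1 := congrFun h (N / 2)
  simp only at h1
  rwa [min_eq_right (le_min (by omega) (by omega) : r ≤ min (N / 2 + 1) (N + 1 - N / 2)),
    min_eq_right (le_min (by omega) (by omega) : r' ≤ min (N / 2 + 1) (N + 1 - N / 2))] at h1

/-- **EXACTLY `⌊N/2⌋ + 2` RANK ROWS occur among all coefficient sequences `q : ℕ → K` — over EVERY field.** -/
theorem ncard_range_rankRow : (Set.range (fun q : ℕ → K => fun k => (hankel1 K N k q).rank)).ncard = N / 2 + 2 := by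
  rw [range_rankRow_eq, (injOn_trapezoidRow (N := N)).ncard_image, ← Finset.coe_Iic, Set.ncard_coe_finset, Nat.card_Iic]

/-- **… and EXACTLY `⌊N/2⌋ + 2` DIMENSION ROWS `k ↦ dim V(univ, w_N(q), k)` among all classes `w_N(q)`** (THEOREM H): the census table has at most — and, over every field, exactly —
`⌊N/2⌋ + 2` distinct rows for the classes `w_N(q)`, all of them already shown by `0` and the pure powers `Θ^p/p!`, `p ≤ ⌊N/2⌋`. -/
theorem ncard_range_finrankRow :
    (Set.range (fun q : ℕ → K => fun k => finrank K ↥(V K (In N) Finset.univ (w K N N q) k))).ncard = N / 2 + 2 := by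
  have hrange : Set.range (fun q : ℕ → K => fun k => finrank K ↥(V K (In N) Finset.univ (w K N N q) k))
      = (fun (f : ℕ → ℕ) k => N.choose k * f k) '' Set.range (fun q : ℕ → K => fun k => (hankel1 K N k q).rank) := by
    ext g
    simp only [Set.mem_range, Set.mem_image, exists_exists_eq_and]
    constructor
    · rintro ⟨q, rfl⟩
      exact ⟨q, funext fun k => (finrank_V_w K k q).symm⟩
    · rintro ⟨q, rfl⟩
      exact ⟨q, funext fun k => finrank_V_w K k q⟩
  have hinj : Set.InjOn (fun (f : ℕ → ℕ) k => N.choose k * f k) (Set.range (fun q : ℕ → K => fun k => (hankel1 K N k q).rank)) := by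
    rintro _ ⟨q, rfl⟩ _ ⟨q', rfl⟩ h
    funext k
    have hk := congrFun h k
    simp only at hk
    show (hankel1 K N k q).rank = (hankel1 K N k q').rank
    rcases le_or_gt k N with hkN | hkN
    · exact Nat.eq_of_mul_eq_mul_left (Nat.choose_pos hkN) hk
    · rw [rank_hankel1_eq_min' K k q, rank_hankel1_eq_min' K k q', show N + 1 - k = 0 by omega, Nat.min_zero, Nat.zero_min, Nat.zero_min]
  rw [hrange, hinj.ncard_image, ncard_range_rankRow]

end Summit.Ventures.HSemireg.Wedge.HankelOuter
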